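import Literature.NumberTheory.GaloisRepresentations.GSp4DecompositionStabilizer
import Mathlib.LinearAlgebra.BilinearForm.Orthogonal
import Mathlib.LinearAlgebra.Matrix.SesquilinearForm
import Mathlib.LinearAlgebra.Matrix.Block
import Mathlib.LinearAlgebra.Matrix.Nondegenerate
import Mathlib.LinearAlgebra.Matrix.NonsingularInverse
import Mathlib.LinearAlgebra.Matrix.ToLin
import Mathlib.LinearAlgebra.FiniteDimensional.Lemmas
import Mathlib.LinearAlgebra.Dimension.Free
import Mathlib.LinearAlgebra.Matrix.Notation
import Mathlib.Data.Set.Card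
import Mathlib.Data.ZMod.Basic
import Mathlib.Topology.Instances.ZMod
import Mathlib.Tactic.FinCases
import HarnessLib

/-!
# The stabiliser of a non-degenerate plane pair in `GSp₄(𝔽₃)` has `2304` elements

Topic `Literature/NumberTheory/GaloisRepresentations`.  A PROVED, fact-free companion to the two
typings of [BCGP25, Lemma 6.4.3 / Table 6.4.4, ticked row `3.45.1` (`|Γ′| = 2304`)] in the tree:
the ORDER form `Literature.NumberTheory.DiophantineGeometry.bcgp2025_lemma643_modThreeImage_order2304`
(hypothesis `Nat.card (ρ̄.imageOn ⊤) = 2304`) and the STRUCTURAL form (the image of `ρ̄` is exactly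
the stabiliser in `GSp(J)(𝔽₃)` of an unordered pair `{P, P^⊥}` of complementary non-degenerate
planes, `FramedGaloisRep.HasDecompositionStabilizerImage` of `GSp4DecompositionStabilizer.lean`).
This file proves the finite-group statement linking them ("(S⇒O)" in the venture cell
`pub-residmod`, lead rulings R86/R87):

* `card_stabSet` — for an invertible alternating `J ∈ M₄(𝔽₃)` and a plane `P ≤ 𝔽₃⁴` with
  `dim P = 2` and `𝔽₃⁴ = P ⊕ P^⊥` (`P^⊥` the right orthogonal of `P` for `(u, v) ↦ uᵀ J v`,
  Mathlib `(Matrix.toBilin' J).orthogonal P`), the set of matrices `M` with `Mᵀ J M = c J` for some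
  unit `c` and `M(P) ∈ {P, P^⊥}` has exactly `2304` elements;
* `FramedGaloisRep.natCard_imageOn_top_of_decompositionStabilizer` — hence a framed Galois
  representation `ρ : Γ_F → GL₄(𝔽₃)` whose values are similitudes of `J` and whose image is exactly
  that stabiliser (clauses (i), (ii) of `HasDecompositionStabilizerImage`, stated here in unfolded
  form so that this file does not depend on that one) has `Nat.card (ρ.imageOn ⊤) = 2304`, which is
  the hypothesis `hcard` of the order-form fact.

In the vocabulary of `GSp4DecompositionStabilizer.lean` (imported): `natCard_GL_similitude_stabilizesPlanePair`
is VERBATIM the finite-group hypothesis `hSO` of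
`Literature.NumberTheory.DiophantineGeometry.card_imageOn_top_eq_of_hasDecompositionStabilizerImage`
/ `…_liftingConditions_of_order2304` / `…_modular_abelianSurface`
(`Bcgp2025ModThreeDecompositionImageModular.lean`), now a theorem; and
`FramedGaloisRep.natCard_imageOn_top_of_hasDecompositionStabilizerImage` takes
`ρ.HasDecompositionStabilizerImage J` itself.  So the structural binder discharges the order binder;
no new named fact (D-0026: net debt 0).

## Proof

Elementary linear algebra, written out because a kernel enumeration of `GSp₄(𝔽₃)` (order
`103 680`) is out of reach: choose bases `p₀, p₁` of `P` and `q₀, q₁` of `P^⊥`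
(`Module.finBasisOfFinrankEq`); non-degeneracy of `J` on `P` and on `P^⊥` gives
`a = B(p₀, p₁) ≠ 0`, `b = B(q₀, q₁) ≠ 0`, so in the adapted basis the Gram matrix is the block form
`G a b = diag(a·j, b·j)`, `j = [[0,1],[-1,0]]` (`gram_eq`), and the change-of-basis matrix is
invertible (`det_Rm_ne_zero`, from `det G = a² b² ≠ 0`).  Conjugation by it (plus the re-indexing
`Fin 2 ⊕ Fin 2 ≃ Fin 4`) is a bijection of matrix spaces carrying the similitude equation for `J`
to the one for `G a b` (`simil_iff`) and the conditions `M(P) = P`, `M(P) = P^⊥` to the conditions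
that the conjugate maps the coordinate plane `E = ⟨e₁, e₂⟩` onto `E`, resp. onto `E′ = ⟨e₃, e₄⟩`
(`map_eq_iff`, `map_θL_Einl`, `map_θL_Einr`).  In standard form a similitude `N` with `N(E) = E` is
block-diagonal `diag(A, D)` with `det A = det D = c` (`simil_diag`), and one with `N(E) = E′` is
block-anti-diagonal with `det X = det Y = abc` (`simil_antidiag`, using `a² = b² = 1` in `𝔽₃`); both
pieces are in bijection with `T = {(A, D) ∈ M₂(𝔽₃)² : det A = det D ≠ 0}`, whose cardinality
`2 · 24 · 24 = 1152` is a `decide` computation over the `81` matrices of `M₂(𝔽₃)` (`card_T`); total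
`2304` (`card_std`).  The count `2304 = |Δ ⋊ ℤ/2|`, `Δ = {(A, B) ∈ GL₂(𝔽₃)² : det A = det B}`,
is the printed order of the class ([CCG20, Lemma 2]; [BCGP25, Table 6.4.4 row 3.45.1, §10.1]).

## References

* [BoxerCalegariGeePilloni2025] G. Boxer, F. Calegari, T. Gee, V. Pilloni, *Modularity theorems
  for abelian surfaces*, arXiv:2502.20645: Lemma 6.4.3, Table 6.4.4 (row `3.45.1 | 2304`), §10.1.
* [CalegariChidambaramGhitza2019] F. Calegari, S. Chidambaram, A. Ghitza, *Some modular abelian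
  surfaces*, Math. Comp. 89 (2020): Lemma 2 (`G₂₃₀₄ = Δ ⋊ ℤ/2`, the unique subgroup of order `2304`).
-/

namespace Literature.NumberTheory.GaloisRepresentations

namespace GSp4DecompStabCount

open Matrix

/-- The field `𝔽₃` (`ZMod 3`). [folklore] -/
abbrev k := ZMod 3
/-- `2 × 2` matrices over `𝔽₃`. [folklore] -/
abbrev M2 := Matrix (Fin 2) (Fin 2) k
/-- The block index type `Fin 2 ⊕ Fin 2` (re-indexed to `Fin 4` by `σ`). [folklore] -/
abbrev ι := Fin 2 ⊕ Fin 2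

/-- The standard alternating `2 × 2` form `j = [[0, 1], [-1, 0]]`. [folklore] -/
def j2 : M2 := !![0, 1; -1, 0]

/-- Every `2 × 2` matrix is a similitude of `j` with multiplier its determinant: `Aᵀ j A = det A · j`. [folklore] -/
private theorem transpose_mul_j2_mul (A : M2) : Aᵀ * j2 * A = A.det • j2 := by
  ext i j
  fin_cases i <;> fin_cases j <;>
    simp [j2, Matrix.mul_apply, Fin.sum_univ_two, Matrix.det_fin_two] <;> ring

/-- `Aᵀ (a j) A = (a det A) · j`. [folklore] -/
private theorem transpose_mul_smul_j2_mul (a : k) (A : M2) : Aᵀ * (a • j2) * A = (a * A.det) • j2 := by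
  rw [Matrix.mul_smul, Matrix.smul_mul, transpose_mul_j2_mul, smul_smul]

/-- `det j = 1`. [folklore] -/
private theorem det_j2 : j2.det = 1 := by
  simp [j2, Matrix.det_fin_two]

/-- `s · j = t · j` implies `s = t` (compare the `(0,1)` entries). [folklore] -/
private theorem smul_j2_inj {s t : k} (h : s • j2 = t • j2) : s = t := by
  have := congr_fun (congr_fun h 0) 1
  simpa [j2] using this

/-- In `𝔽₃` a non-zero element has square `1`. [folklore] -/
private theorem sq_eq_one_of_ne_zero (a : k) (ha : a ≠ 0) : a * a = 1 := by
  revert a; decide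

/-! ### the standard form `G a b = diag(a·j, b·j)` and the coordinate planes -/

/-- The standard Gram matrix `G a b = diag(a·j, b·j)` of an alternating form on `𝔽₃⁴` adapted to a plane decomposition. [folklore] -/
def G (a b : k) : Matrix ι ι k := Matrix.fromBlocks (a • j2) 0 0 (b • j2)

/-- The coordinate plane `E = ⟨e₁, e₂⟩` of `𝔽₃^(Fin 2 ⊕ Fin 2)` (vectors vanishing on the `inr` coordinates). [folklore] -/
def Einl : Submodule k (ι → k) where
  carrier := {v | ∀ i, v (Sum.inr i) = 0}
  zero_mem' := by intro i; rfl
  add_mem' := by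
    intro v w hv hw i
    simp only [Pi.add_apply, hv i, hw i, add_zero]
  smul_mem' := by
    intro c v hv i
    simp only [Pi.smul_apply, hv i, smul_eq_mul, mul_zero]

/-- The coordinate plane `E′ = ⟨e₃, e₄⟩` (vectors vanishing on the `inl` coordinates). [folklore] -/
def Einr : Submodule k (ι → k) where
  carrier := {v | ∀ i, v (Sum.inl i) = 0}
  zero_mem' := by intro i; rfl
  add_mem' := by
    intro v w hv hw i
    simp only [Pi.add_apply, hv i, hw i, add_zero]
  smul_mem' := by
    intro c v hv i
    simp only [Pi.smul_apply, hv i, smul_eq_mul, mul_zero]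

/-- Membership in `Einl` (unfolding). [folklore] -/
private theorem mem_Einl {v : ι → k} : v ∈ Einl ↔ ∀ i, v (Sum.inr i) = 0 := Iff.rfl
/-- Membership in `Einr` (unfolding). [folklore] -/
private theorem mem_Einr {v : ι → k} : v ∈ Einr ↔ ∀ i, v (Sum.inl i) = 0 := Iff.rfl

/-- `(u, 0) ∈ E`. [folklore] -/
private theorem sum_elim_zero_mem_Einl (u : Fin 2 → k) : Sum.elim u (0 : Fin 2 → k) ∈ Einl := fun _ => rfl
/-- `(0, w) ∈ E′`. [folklore] -/
private theorem sum_elim_zero_mem_Einr (w : Fin 2 → k) : Sum.elim (0 : Fin 2 → k) w ∈ Einr := fun _ => rfl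

/-- A vector of `E` is `(v|inl, 0)`. [folklore] -/
private theorem eq_sum_elim_of_mem_Einl {v : ι → k} (hv : v ∈ Einl) : v = Sum.elim (v ∘ Sum.inl) (0 : Fin 2 → k) := by
  ext x; rcases x with i | i
  · rfl
  · exact hv i

/-- A vector of `E′` is `(0, v|inr)`. [folklore] -/
private theorem eq_sum_elim_of_mem_Einr {v : ι → k} (hv : v ∈ Einr) : v = Sum.elim (0 : Fin 2 → k) (v ∘ Sum.inr) := by
  ext x; rcases x with i | i
  · exact hv i
  · rfl

/-- The basis vectors `e_(inl j)` lie in `E`. [folklore] -/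
private theorem single_inl_mem_Einl (j : Fin 2) : (Pi.single (Sum.inl j) (1 : k) : ι → k) ∈ Einl := by
  intro i; simp

/-- `E ≠ E′`. [folklore] -/
private theorem Einl_ne_Einr : Einl ≠ Einr := by
  intro h
  have h1 : (Pi.single (Sum.inl 0) (1 : k) : ι → k) ∈ Einr := h ▸ single_inl_mem_Einl 0
  have := h1 0
  simp at this

/-! ### block computations -/

/-- Block formula for `Nᵀ (G a b) N` with `N` written in `2 × 2` blocks. [folklore] -/
private theorem blocks_simil (a b : k) (A X Y D : M2) :
    (fromBlocks A X Y D)ᵀ * G a b * fromBlocks A X Y D =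
      fromBlocks (Aᵀ * (a • j2) * A + Yᵀ * (b • j2) * Y) (Aᵀ * (a • j2) * X + Yᵀ * (b • j2) * D)
        (Xᵀ * (a • j2) * A + Dᵀ * (b • j2) * Y) (Xᵀ * (a • j2) * X + Dᵀ * (b • j2) * D) := by
  simp only [G, Matrix.fromBlocks_transpose, Matrix.fromBlocks_multiply, Matrix.mul_zero,
    add_zero, zero_add]

/-- `c · G a b = G (ca) (cb)` blockwise. [folklore] -/
private theorem smul_G (a b c : k) : c • G a b = fromBlocks ((c * a) • j2) 0 0 ((c * b) • j2) := by
  simp only [G, Matrix.fromBlocks_smul, smul_zero, smul_smul]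

/-- a matrix killed on the left by an invertible matrix is zero [folklore] -/
private theorem eq_zero_of_mul_eq_zero {B X : M2} (hB : B.det ≠ 0) (h : B * X = 0) : X = 0 := by
  have hu : IsUnit B.det := isUnit_iff_ne_zero.mpr hB
  calc X = (B⁻¹ * B) * X := by rw [Matrix.nonsing_inv_mul B hu, Matrix.one_mul]
    _ = B⁻¹ * (B * X) := by rw [Matrix.mul_assoc]
    _ = 0 := by rw [h, Matrix.mul_zero]

/-- diagonal case: lower-left block zero forces upper-right zero and `det A = det D = c` [folklore] -/
private theorem simil_diag {a b c : k} (ha : a ≠ 0) (hb : b ≠ 0) (hc : c ≠ 0) {A X D : M2}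
    (h : (fromBlocks A X 0 D)ᵀ * G a b * fromBlocks A X 0 D = c • G a b) :
    X = 0 ∧ A.det = c ∧ D.det = c := by
  rw [blocks_simil, smul_G] at h
  obtain ⟨h11, h12, -, h22⟩ := Matrix.fromBlocks_inj.mp h
  simp only [Matrix.transpose_zero, Matrix.zero_mul, add_zero] at h11 h12 h22
  rw [transpose_mul_smul_j2_mul] at h11
  have hA : A.det = c := by
    have := smul_j2_inj h11
    -- a * det A = c * a
    have h' : a * (A.det - c) = 0 := by rw [mul_sub]; rw [this]; ring
    rcases mul_eq_zero.mp h' with h'' | h''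
    · exact absurd h'' ha
    · exact sub_eq_zero.mp h''
  have hX : X = 0 := by
    apply eq_zero_of_mul_eq_zero (B := Aᵀ * (a • j2)) _ h12
    rw [Matrix.det_mul, Matrix.det_transpose, Matrix.det_smul, det_j2, hA]
    simp only [Fintype.card_fin, mul_one]
    exact mul_ne_zero hc (pow_ne_zero _ ha)
  subst hX
  simp only [Matrix.transpose_zero, Matrix.zero_mul, zero_add] at h22
  rw [transpose_mul_smul_j2_mul] at h22
  have hD : D.det = c := by
    have := smul_j2_inj h22
    have h' : b * (D.det - c) = 0 := by rw [mul_sub]; rw [this]; ring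
    rcases mul_eq_zero.mp h' with h'' | h''
    · exact absurd h'' hb
    · exact sub_eq_zero.mp h''
  exact ⟨rfl, hA, hD⟩

/-- anti-diagonal case: upper-left block zero forces lower-right zero and the determinant relations [folklore] -/
private theorem simil_antidiag {a b c : k} (ha : a ≠ 0) (hb : b ≠ 0) (hc : c ≠ 0) {X Y D : M2}
    (h : (fromBlocks 0 X Y D)ᵀ * G a b * fromBlocks 0 X Y D = c • G a b) :
    D = 0 ∧ a * X.det = c * b ∧ b * Y.det = c * a := by
  rw [blocks_simil, smul_G] at h
  obtain ⟨h11, h12, -, h22⟩ := Matrix.fromBlocks_inj.mp h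
  simp only [Matrix.transpose_zero, Matrix.zero_mul, Matrix.mul_zero, zero_add] at h11 h12 h22
  rw [transpose_mul_smul_j2_mul] at h11
  have hY : b * Y.det = c * a := smul_j2_inj h11
  have hYdet : Y.det ≠ 0 := by
    intro h0; rw [h0, mul_zero] at hY; exact mul_ne_zero hc ha hY.symm
  have hD : D = 0 := by
    apply eq_zero_of_mul_eq_zero (B := Yᵀ * (b • j2)) _ h12
    rw [Matrix.det_mul, Matrix.det_transpose, Matrix.det_smul, det_j2]
    simp only [Fintype.card_fin, mul_one]
    exact mul_ne_zero hYdet (pow_ne_zero _ hb)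
  subst hD
  simp only [Matrix.transpose_zero, Matrix.zero_mul, add_zero] at h22
  rw [transpose_mul_smul_j2_mul] at h22
  exact ⟨rfl, smul_j2_inj h22, hY⟩


/-! ### the coordinate-plane lemmas -/

/-- If `N(E) = E` then the lower-left block of `N` vanishes. [folklore] -/
private theorem toBlocks₂₁_eq_zero_of_map_eq {N : Matrix ι ι k}
    (h : Einl.map (Matrix.toLin' N) = Einl) : N.toBlocks₂₁ = 0 := by
  ext i j
  have hmem : Matrix.toLin' N (Pi.single (Sum.inl j) 1) ∈ Einl := by
    rw [← h]; exact Submodule.mem_map_of_mem (single_inl_mem_Einl j)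
  have := hmem i
  simpa [Matrix.toLin'_apply, Matrix.mulVec_single, Matrix.toBlocks₂₁] using this

/-- If `N(E) = E′` then the upper-left block of `N` vanishes. [folklore] -/
private theorem toBlocks₁₁_eq_zero_of_map_eq {N : Matrix ι ι k}
    (h : Einl.map (Matrix.toLin' N) = Einr) : N.toBlocks₁₁ = 0 := by
  ext i j
  have hmem : Matrix.toLin' N (Pi.single (Sum.inl j) 1) ∈ Einr := by
    rw [← h]; exact Submodule.mem_map_of_mem (single_inl_mem_Einl j)
  have := hmem i
  simpa [Matrix.toLin'_apply, Matrix.mulVec_single, Matrix.toBlocks₁₁] using this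

/-- The `inr` part of a vector of `E` is zero. [folklore] -/
private theorem comp_inr_eq_zero_of_mem_Einl {v : ι → k} (hv : v ∈ Einl) : v ∘ Sum.inr = 0 :=
  funext hv

/-- The `inl` part of a vector of `E′` is zero. [folklore] -/
private theorem comp_inl_eq_zero_of_mem_Einr {v : ι → k} (hv : v ∈ Einr) : v ∘ Sum.inl = 0 :=
  funext hv

/-- A block-diagonal matrix with invertible upper block maps `E` onto `E`. [folklore] -/
private theorem map_Einl_diag {A D : M2} (hA : A.det ≠ 0) :
    Einl.map (Matrix.toLin' (fromBlocks A 0 0 D)) = Einl := by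
  have hu : IsUnit A.det := isUnit_iff_ne_zero.mpr hA
  apply le_antisymm
  · rintro _ ⟨v, hv, rfl⟩ i
    simp [Matrix.toLin'_apply, Matrix.fromBlocks_mulVec, comp_inr_eq_zero_of_mem_Einl hv]
  · intro v hv
    refine ⟨Sum.elim (A⁻¹ *ᵥ (v ∘ Sum.inl)) 0, sum_elim_zero_mem_Einl _, ?_⟩
    conv_rhs => rw [eq_sum_elim_of_mem_Einl hv]
    rw [Matrix.toLin'_apply, Matrix.fromBlocks_mulVec]
    simp only [Sum.elim_comp_inl, Sum.elim_comp_inr, Matrix.zero_mulVec, Matrix.mulVec_zero,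
      add_zero, Matrix.mulVec_mulVec, Matrix.mul_nonsing_inv _ hu, Matrix.one_mulVec,
      Matrix.zero_mul]

/-- A block-anti-diagonal matrix with invertible lower-left block maps `E` onto `E′`. [folklore] -/
private theorem map_Einl_antidiag {X Y : M2} (hY : Y.det ≠ 0) :
    Einl.map (Matrix.toLin' (fromBlocks 0 X Y 0)) = Einr := by
  have hu : IsUnit Y.det := isUnit_iff_ne_zero.mpr hY
  apply le_antisymm
  · rintro _ ⟨v, hv, rfl⟩ i
    simp [Matrix.toLin'_apply, Matrix.fromBlocks_mulVec, comp_inr_eq_zero_of_mem_Einl hv]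
  · intro w hw
    refine ⟨Sum.elim (Y⁻¹ *ᵥ (w ∘ Sum.inr)) 0, sum_elim_zero_mem_Einl _, ?_⟩
    conv_rhs => rw [eq_sum_elim_of_mem_Einr hw]
    rw [Matrix.toLin'_apply, Matrix.fromBlocks_mulVec]
    simp only [Sum.elim_comp_inl, Sum.elim_comp_inr, Matrix.zero_mulVec, Matrix.mulVec_zero,
      add_zero, Matrix.mulVec_mulVec, Matrix.mul_nonsing_inv _ hu, Matrix.one_mulVec,
      Matrix.zero_mul]

/-! ### the two pieces of the standard stabiliser and their counts -/

/-- similitude of the standard form with a non-zero multiplier [folklore] -/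
private def IsSim (a b : k) (N : Matrix ι ι k) : Prop := ∃ c : k, c ≠ 0 ∧ Nᵀ * G a b * N = c • G a b

/-- The similitudes of `G a b` mapping `E` onto `E` (the block-diagonal piece). [folklore] -/
def S0 (a b : k) : Set (Matrix ι ι k) := {N | IsSim a b N ∧ Einl.map (Matrix.toLin' N) = Einl}
/-- The similitudes of `G a b` mapping `E` onto `E′` (the block-anti-diagonal piece). [folklore] -/
def S1 (a b : k) : Set (Matrix ι ι k) := {N | IsSim a b N ∧ Einl.map (Matrix.toLin' N) = Einr}

/-- the pairs `(A, D)` with `det A = det D ≠ 0` [folklore] -/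
def T : Type := {p : M2 × M2 // p.1.det = p.2.det ∧ p.1.det ≠ 0}

/-- `T` is a finite type (pairs of `2 × 2` matrices over `𝔽₃`). [folklore] -/
instance : Fintype T := by unfold T; infer_instance

/-- A non-zero element of `𝔽₃` is `1` or `2`. [folklore] -/
private theorem ne_zero_cases (a : k) (ha : a ≠ 0) : a = 1 ∨ a = 2 := by
  revert a; decide

/-- `M₂(𝔽₃)` has exactly `24` matrices of each non-zero determinant (kernel computation over `81` matrices). [folklore] -/
private theorem card_det_eq (c : k) (hc : c ≠ 0) : Fintype.card {A : M2 // A.det = c} = 24 := by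
  rcases ne_zero_cases c hc with rfl | rfl <;> decide

/-- `|T| = 2 · 24 · 24 = 1152`. [folklore] -/
private theorem card_T : Fintype.card T = 1152 := by
  let e : T ≃ Σ c : {c : k // c ≠ 0}, ({A : M2 // A.det = c} × {D : M2 // D.det = c}) :=
    { toFun := fun p => ⟨⟨p.1.1.det, p.2.2⟩, ⟨p.1.1, rfl⟩, ⟨p.1.2, p.2.1.symm⟩⟩
      invFun := fun s => ⟨(s.2.1.1, s.2.2.1), by
        obtain ⟨⟨c, hc⟩, ⟨A, hA⟩, ⟨D, hD⟩⟩ := s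
        exact ⟨by simp [hA, hD], by simpa [hA] using hc⟩⟩
      left_inv := by rintro ⟨⟨A, D⟩, h⟩; rfl
      right_inv := by
        rintro ⟨⟨c, hc⟩, ⟨A, hA⟩, ⟨D, hD⟩⟩
        cases hA
        rfl }
  rw [Fintype.card_congr e, Fintype.card_sigma]
  have h24 : ∀ c : {c : k // c ≠ 0},
      Fintype.card ({A : M2 // A.det = (c : k)} × {D : M2 // D.det = (c : k)}) = 576 := by
    intro c
    rw [Fintype.card_prod, card_det_eq c.1 c.2]
  simp_rw [h24]
  simp only [Finset.sum_const, Finset.card_univ, smul_eq_mul]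
  have : Fintype.card {c : k // c ≠ 0} = 2 := by decide
  rw [this]

section pieces
variable {a b : k}

/-- Block description of the elements of `S0`. [folklore] -/
private theorem S0_blocks (ha : a ≠ 0) (hb : b ≠ 0) {N : Matrix ι ι k} (hN : N ∈ S0 a b) :
    N.toBlocks₁₂ = 0 ∧ N.toBlocks₂₁ = 0 ∧ N.toBlocks₁₁.det = N.toBlocks₂₂.det ∧
      N.toBlocks₁₁.det ≠ 0 := by
  obtain ⟨⟨c, hc, hsim⟩, hmap⟩ := hN
  have h21 := toBlocks₂₁_eq_zero_of_map_eq hmap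
  have hN' : N = fromBlocks N.toBlocks₁₁ N.toBlocks₁₂ 0 N.toBlocks₂₂ := by
    conv_lhs => rw [← Matrix.fromBlocks_toBlocks N]
    rw [h21]
  rw [hN'] at hsim
  obtain ⟨h12, hA, hD⟩ := simil_diag ha hb hc hsim
  exact ⟨h12, h21, by rw [hA, hD], by rw [hA]; exact hc⟩

/-- Block-diagonal matrices with `det A = det D ≠ 0` lie in `S0`. [folklore] -/
private theorem fromBlocks_mem_S0 {A D : M2} (h : A.det = D.det) (h0 : A.det ≠ 0) :
    fromBlocks A 0 0 D ∈ S0 a b := by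
  refine ⟨⟨A.det, h0, ?_⟩, map_Einl_diag h0⟩
  rw [blocks_simil, smul_G]
  simp only [Matrix.transpose_zero, Matrix.zero_mul, Matrix.mul_zero, add_zero, zero_add,
    transpose_mul_smul_j2_mul, ← h, mul_comm a, mul_comm b]

/-- Block description of the elements of `S1` (uses `a² = b² = 1` in `𝔽₃`). [folklore] -/
private theorem S1_blocks (ha : a ≠ 0) (hb : b ≠ 0) {N : Matrix ι ι k} (hN : N ∈ S1 a b) :
    N.toBlocks₁₁ = 0 ∧ N.toBlocks₂₂ = 0 ∧ N.toBlocks₁₂.det = N.toBlocks₂₁.det ∧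
      N.toBlocks₁₂.det ≠ 0 := by
  obtain ⟨⟨c, hc, hsim⟩, hmap⟩ := hN
  have h11 := toBlocks₁₁_eq_zero_of_map_eq hmap
  have hN' : N = fromBlocks 0 N.toBlocks₁₂ N.toBlocks₂₁ N.toBlocks₂₂ := by
    conv_lhs => rw [← Matrix.fromBlocks_toBlocks N]
    rw [h11]
  rw [hN'] at hsim
  obtain ⟨h22, hX, hY⟩ := simil_antidiag ha hb hc hsim
  -- over 𝔽₃: a * det X = c * b and b * det Y = c * a give det X = det Y = a * b * c
  have hX' : N.toBlocks₁₂.det = a * b * c := by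
    calc N.toBlocks₁₂.det = (a * a) * N.toBlocks₁₂.det := by rw [sq_eq_one_of_ne_zero a ha, one_mul]
      _ = a * (a * N.toBlocks₁₂.det) := by ring
      _ = a * (c * b) := by rw [hX]
      _ = a * b * c := by ring
  have hY' : N.toBlocks₂₁.det = a * b * c := by
    calc N.toBlocks₂₁.det = (b * b) * N.toBlocks₂₁.det := by rw [sq_eq_one_of_ne_zero b hb, one_mul]
      _ = b * (b * N.toBlocks₂₁.det) := by ring
      _ = b * (c * a) := by rw [hY]
      _ = a * b * c := by ring
  refine ⟨h11, h22, by rw [hX', hY'], ?_⟩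
  rw [hX']; exact mul_ne_zero (mul_ne_zero ha hb) hc

/-- Block-anti-diagonal matrices with `det X = det Y ≠ 0` lie in `S1`. [folklore] -/
private theorem fromBlocks_mem_S1 (ha : a ≠ 0) (hb : b ≠ 0) {X Y : M2} (h : X.det = Y.det)
    (h0 : X.det ≠ 0) : fromBlocks 0 X Y 0 ∈ S1 a b := by
  refine ⟨⟨a * b * X.det, mul_ne_zero (mul_ne_zero ha hb) h0, ?_⟩, map_Einl_antidiag (h ▸ h0)⟩
  have e1 : b * Y.det = a * b * X.det * a := by
    calc b * Y.det = b * X.det := by rw [h]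
      _ = (a * a) * b * X.det := by rw [sq_eq_one_of_ne_zero a ha, one_mul]
      _ = a * b * X.det * a := by ring
  have e2 : a * X.det = a * b * X.det * b := by
    calc a * X.det = a * (b * b) * X.det := by rw [sq_eq_one_of_ne_zero b hb, mul_one]
      _ = a * b * X.det * b := by ring
  rw [blocks_simil, smul_G]
  simp only [Matrix.transpose_zero, Matrix.zero_mul, Matrix.mul_zero, add_zero, zero_add,
    transpose_mul_smul_j2_mul, e1, e2]

/-- `S0 ≃ T` [folklore] -/
def S0Equiv (ha : a ≠ 0) (hb : b ≠ 0) : S0 a b ≃ T where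
  toFun N := ⟨(N.1.toBlocks₁₁, N.1.toBlocks₂₂), (S0_blocks ha hb N.2).2.2⟩
  invFun p := ⟨fromBlocks p.1.1 0 0 p.1.2, fromBlocks_mem_S0 p.2.1 p.2.2⟩
  left_inv N := by
    obtain ⟨h12, h21, -, -⟩ := S0_blocks ha hb N.2
    apply Subtype.ext
    change fromBlocks N.1.toBlocks₁₁ 0 0 N.1.toBlocks₂₂ = N.1
    conv_rhs => rw [← Matrix.fromBlocks_toBlocks N.1]
    rw [h12, h21]
  right_inv p := by
    apply Subtype.ext
    change ((fromBlocks p.1.1 0 0 p.1.2).toBlocks₁₁, (fromBlocks p.1.1 0 0 p.1.2).toBlocks₂₂) = p.1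
    simp

/-- `S1 ≃ T` [folklore] -/
def S1Equiv (ha : a ≠ 0) (hb : b ≠ 0) : S1 a b ≃ T where
  toFun N := ⟨(N.1.toBlocks₁₂, N.1.toBlocks₂₁), (S1_blocks ha hb N.2).2.2⟩
  invFun p := ⟨fromBlocks 0 p.1.1 p.1.2 0, fromBlocks_mem_S1 ha hb p.2.1 p.2.2⟩
  left_inv N := by
    obtain ⟨h11, h22, -, -⟩ := S1_blocks ha hb N.2
    apply Subtype.ext
    change fromBlocks 0 N.1.toBlocks₁₂ N.1.toBlocks₂₁ 0 = N.1
    conv_rhs => rw [← Matrix.fromBlocks_toBlocks N.1]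
    rw [h11, h22]
  right_inv p := by
    apply Subtype.ext
    change ((fromBlocks 0 p.1.1 p.1.2 0).toBlocks₁₂, (fromBlocks 0 p.1.1 p.1.2 0).toBlocks₂₁) = p.1
    simp

/-- `|S0| = 1152`. [folklore] -/
private theorem card_S0 (ha : a ≠ 0) (hb : b ≠ 0) : Nat.card (S0 a b) = 1152 := by
  rw [Nat.card_congr (S0Equiv ha hb), Nat.card_eq_fintype_card, card_T]

/-- `|S1| = 1152`. [folklore] -/
private theorem card_S1 (ha : a ≠ 0) (hb : b ≠ 0) : Nat.card (S1 a b) = 1152 := by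
  rw [Nat.card_congr (S1Equiv ha hb), Nat.card_eq_fintype_card, card_T]

/-- **The standard count.** [folklore] -/
private theorem card_std (ha : a ≠ 0) (hb : b ≠ 0) :
    Nat.card {N : Matrix ι ι k // IsSim a b N ∧
      (Einl.map (Matrix.toLin' N) = Einl ∨ Einl.map (Matrix.toLin' N) = Einr)} = 2304 := by
  have hset : {N : Matrix ι ι k | IsSim a b N ∧
      (Einl.map (Matrix.toLin' N) = Einl ∨ Einl.map (Matrix.toLin' N) = Einr)} = S0 a b ∪ S1 a b := by
    ext N
    simp only [S0, S1, Set.mem_setOf_eq, Set.mem_union]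
    tauto
  have hdisj : Disjoint (S0 a b) (S1 a b) := by
    rw [Set.disjoint_left]
    rintro N ⟨-, h0⟩ ⟨-, h1⟩
    exact Einl_ne_Einr (h0.symm.trans h1)
  have h1 : Nat.card (S0 a b ∪ S1 a b : Set (Matrix ι ι k)) = 2304 := by
    rw [Nat.card_coe_set_eq, Set.ncard_union_eq hdisj, ← Nat.card_coe_set_eq,
      ← Nat.card_coe_set_eq, card_S0 ha hb, card_S1 ha hb]
  rw [← h1]
  exact Nat.card_congr (Equiv.subtypeEquivRight (fun N => Set.ext_iff.mp hset N))

end pieces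


/-! ## The abstract layer: an invertible alternating `J` on `𝔽₃⁴` and a non-degenerate plane `P` -/

section abstractLayer

/-- `𝔽₃⁴` as `Fin 4 → 𝔽₃`. [folklore] -/
abbrev V := Fin 4 → k

/-- the bilinear form `B(u, v) = uᵀ J v` [folklore] -/
private theorem toBilin'_apply_eq (J : Matrix (Fin 4) (Fin 4) k) (u v : V) :
    Matrix.toBilin' J u v = u ⬝ᵥ (J *ᵥ v) := Matrix.toBilin'_apply' J u v

/-- For alternating `J` (`Jᵀ = -J`) the form is skew: `B(u, v) = -B(v, u)`. [folklore] -/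
private theorem skew (J : Matrix (Fin 4) (Fin 4) k) (hJt : Jᵀ = -J) (u v : V) :
    u ⬝ᵥ (J *ᵥ v) = -(v ⬝ᵥ (J *ᵥ u)) := by
  rw [Matrix.dotProduct_mulVec, ← Matrix.mulVec_transpose, hJt, Matrix.neg_mulVec,
    dotProduct_comm, dotProduct_neg]

/-- For `Jᵀ = -J` over `𝔽₃`, `B(v, v) = 0`. [folklore] -/
private theorem alternating (J : Matrix (Fin 4) (Fin 4) k) (hJt : Jᵀ = -J) (v : V) :
    v ⬝ᵥ (J *ᵥ v) = 0 := by
  have h := skew J hJt v v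
  have key : ∀ x : k, x = -x → x = 0 := by decide
  exact key _ h

/-- right non-degeneracy: a vector pairing to zero with everything on the left is zero [folklore] -/
private theorem eq_zero_of_forall_left (J : Matrix (Fin 4) (Fin 4) k) (hJt : Jᵀ = -J) (hJd : J.det ≠ 0)
    (v : V) (h : ∀ u : V, u ⬝ᵥ (J *ᵥ v) = 0) : v = 0 := by
  refine (Matrix.nondegenerate_of_det_ne_zero hJd).eq_zero_of_ortho (fun w => ?_)
  have := h w
  rw [skew J hJt] at this
  exact neg_eq_zero.mp this

variable (J : Matrix (Fin 4) (Fin 4) k) (P : Submodule k V)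

/-- notation-free name for `P^⊥` [folklore] -/
abbrev orth : Submodule k V := (Matrix.toBilin' J).orthogonal P

/-- Membership in `P^⊥` (unfolding). [folklore] -/
private theorem mem_orth_iff (v : V) : v ∈ orth J P ↔ ∀ u ∈ P, u ⬝ᵥ (J *ᵥ v) = 0 := by
  simp only [orth, LinearMap.BilinForm.mem_orthogonal_iff, Matrix.toBilin'_apply']

variable {J P}

/-- If `dim P = 2` and `𝔽₃⁴ = P ⊕ P^⊥` then `dim P^⊥ = 2`. [folklore] -/
private theorem finrank_orth (hP2 : Module.finrank k P = 2) (hPc : IsCompl P (orth J P)) :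
    Module.finrank k (orth J P) = 2 := by
  have h := Submodule.finrank_sup_add_finrank_inf_eq P (orth J P)
  rw [hPc.sup_eq_top, hPc.inf_eq_bot, finrank_top, finrank_bot, Module.finrank_fin_fun, hP2] at h
  omega


end abstractLayer

/-! ### bases of `P` and `P^⊥`, the change-of-basis matrix and its Gram matrix -/

section bases
variable (J : Matrix (Fin 4) (Fin 4) k) (P : Submodule k V)
variable (hP2 : Module.finrank k P = 2) (hPc : IsCompl P (orth J P))

/-- a basis of `P` [folklore] -/
noncomputable def bP : Module.Basis (Fin 2) k P := Module.finBasisOfFinrankEq k P hP2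

/-- a basis of `P^⊥` [folklore] -/
noncomputable def bQ : Module.Basis (Fin 2) k (orth J P) :=
  Module.finBasisOfFinrankEq k (orth J P) (finrank_orth hP2 hPc)

/-- the four basis vectors `p₀, p₁, q₀, q₁`, indexed by `ι = Fin 2 ⊕ Fin 2` [folklore] -/
noncomputable def cols : ι → V :=
  Sum.elim (fun i => (bP P hP2 i : V)) (fun i => (bQ J P hP2 hPc i : V))

/-- `cols (inl i) = pᵢ` (unfolding). [folklore] -/
private theorem cols_inl (i : Fin 2) : cols J P hP2 hPc (Sum.inl i) = (bP P hP2 i : V) := rfl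
/-- `cols (inr i) = qᵢ` (unfolding). [folklore] -/
private theorem cols_inr (i : Fin 2) : cols J P hP2 hPc (Sum.inr i) = (bQ J P hP2 hPc i : V) := rfl

/-- `pᵢ ∈ P`. [folklore] -/
private theorem cols_inl_mem (i : Fin 2) : cols J P hP2 hPc (Sum.inl i) ∈ P := (bP P hP2 i).2

/-- `qᵢ ∈ P^⊥`. [folklore] -/
private theorem cols_inr_mem (i : Fin 2) : cols J P hP2 hPc (Sum.inr i) ∈ orth J P := (bQ J P hP2 hPc i).2

/-- the scalar `a = B(p₀, p₁)` [folklore] -/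
noncomputable def sa : k := (bP P hP2 0 : V) ⬝ᵥ (J *ᵥ (bP P hP2 1 : V))
/-- the scalar `b = B(q₀, q₁)` [folklore] -/
noncomputable def sb : k := (bQ J P hP2 hPc 0 : V) ⬝ᵥ (J *ᵥ (bQ J P hP2 hPc 1 : V))

/-- expansion of `B(u, v)` for `u ∈ P` along the basis of `P` [folklore] -/
private theorem pair_of_mem_P (u : V) (hu : u ∈ P) (v : V) :
    u ⬝ᵥ (J *ᵥ v) = (bP P hP2).repr ⟨u, hu⟩ 0 * ((bP P hP2 0 : V) ⬝ᵥ (J *ᵥ v)) +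
      (bP P hP2).repr ⟨u, hu⟩ 1 * ((bP P hP2 1 : V) ⬝ᵥ (J *ᵥ v)) := by
  have hsum := congr_arg (fun x : P => (x : V)) ((bP P hP2).sum_repr ⟨u, hu⟩)
  simp only [Fin.sum_univ_two] at hsum
  conv_lhs => rw [← hsum]
  simp [add_dotProduct, smul_dotProduct]

/-- expansion of `B(w, v)` for `w ∈ P^⊥` along the basis of `P^⊥` [folklore] -/
private theorem pair_of_mem_Q (w : V) (hw : w ∈ orth J P) (v : V) :
    w ⬝ᵥ (J *ᵥ v) = (bQ J P hP2 hPc).repr ⟨w, hw⟩ 0 * ((bQ J P hP2 hPc 0 : V) ⬝ᵥ (J *ᵥ v)) +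
      (bQ J P hP2 hPc).repr ⟨w, hw⟩ 1 * ((bQ J P hP2 hPc 1 : V) ⬝ᵥ (J *ᵥ v)) := by
  have hsum := congr_arg (fun x : orth J P => (x : V)) ((bQ J P hP2 hPc).sum_repr ⟨w, hw⟩)
  simp only [Fin.sum_univ_two] at hsum
  conv_lhs => rw [← hsum]
  simp [add_dotProduct, smul_dotProduct]

include hPc in
/-- `a = B(p₀, p₁) ≠ 0`: otherwise `p₁ ∈ P ∩ P^⊥ = 0`. [folklore] -/
private theorem sa_ne_zero (hJt : Jᵀ = -J) : sa J P hP2 ≠ 0 := by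
  intro ha
  -- `p₁` pairs to zero with all of `P`, hence lies in `P ∩ P^⊥ = 0`
  have h1 : (bP P hP2 1 : V) ∈ orth J P := by
    rw [mem_orth_iff]
    intro u hu
    rw [pair_of_mem_P J P hP2 u hu, alternating J hJt]
    change _ * sa J P hP2 + _ = 0
    rw [ha, mul_zero, mul_zero, add_zero]
  have h2 : (bP P hP2 1 : V) ∈ P ⊓ orth J P := ⟨(bP P hP2 1).2, h1⟩
  rw [hPc.inf_eq_bot, Submodule.mem_bot] at h2
  exact (bP P hP2).ne_zero 1 (Subtype.ext h2)

/-- `b = B(q₀, q₁) ≠ 0`: otherwise `q₁` pairs to zero with `P + P^⊥ = 𝔽₃⁴`, so `q₁ = 0` by non-degeneracy. [folklore] -/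
private theorem sb_ne_zero (hJt : Jᵀ = -J) (hJd : J.det ≠ 0) : sb J P hP2 hPc ≠ 0 := by
  intro hb
  have hq : (bQ J P hP2 hPc 1 : V) = 0 := by
    apply eq_zero_of_forall_left J hJt hJd
    intro v
    have hv : v ∈ P ⊔ orth J P := by rw [hPc.sup_eq_top]; exact Submodule.mem_top
    obtain ⟨u, hu, w, hw, rfl⟩ := Submodule.mem_sup.mp hv
    rw [add_dotProduct]
    have hu0 : u ⬝ᵥ (J *ᵥ (bQ J P hP2 hPc 1 : V)) = 0 :=
      (mem_orth_iff J P _).mp (bQ J P hP2 hPc 1).2 u hu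
    rw [hu0, zero_add, pair_of_mem_Q J P hP2 hPc w hw, alternating J hJt]
    change _ * sb J P hP2 hPc + _ = 0
    rw [hb, mul_zero, mul_zero, add_zero]
  exact (bQ J P hP2 hPc).ne_zero 1 (Subtype.ext hq)


/-! ### the change-of-basis matrix and its Gram matrix -/

/-- `σ : ι ≃ Fin 4` (the standard re-indexing `Fin 2 ⊕ Fin 2 ≃ Fin 4`) [folklore] -/
def σ : ι ≃ Fin 4 := finSumFinEquiv

/-- rows = the basis vectors `p₀, p₁, q₀, q₁` in `σ`-order; its transpose is the change-of-basis
matrix whose columns are the basis vectors [folklore] -/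
noncomputable def Rm : Matrix (Fin 4) (Fin 4) k := Matrix.of fun c => cols J P hP2 hPc (σ.symm c)

/-- Rows of `Rm` (unfolding). [folklore] -/
private theorem Rm_apply (c : Fin 4) : Rm J P hP2 hPc c = cols J P hP2 hPc (σ.symm c) := rfl

/-- Entries of a Gram matrix: `(R J Rᵀ) c c′ = B(R_c, R_c′)`. [folklore] -/
private theorem gram_apply (R J' : Matrix (Fin 4) (Fin 4) k) (c c' : Fin 4) :
    (R * J' * Rᵀ) c c' = R c ⬝ᵥ (J' *ᵥ R c') := by
  rw [Matrix.mul_assoc, Matrix.mul_apply']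
  rfl

/-- `B(pᵢ, pⱼ) = (a·j)ᵢⱼ`. [folklore] -/
private theorem pair_pp (hJt : Jᵀ = -J) (i j : Fin 2) :
    (bP P hP2 i : V) ⬝ᵥ (J *ᵥ (bP P hP2 j : V)) = (sa J P hP2 • j2) i j := by
  fin_cases i <;> fin_cases j
  · simp [j2, alternating J hJt]
  · simp [j2, sa]
  · rw [skew J hJt]; simp [j2, sa]
  · simp [j2, alternating J hJt]

/-- `B(qᵢ, qⱼ) = (b·j)ᵢⱼ`. [folklore] -/
private theorem pair_qq (hJt : Jᵀ = -J) (i j : Fin 2) :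
    (bQ J P hP2 hPc i : V) ⬝ᵥ (J *ᵥ (bQ J P hP2 hPc j : V)) = (sb J P hP2 hPc • j2) i j := by
  fin_cases i <;> fin_cases j
  · simp [j2, alternating J hJt]
  · simp [j2, sb]
  · rw [skew J hJt]; simp [j2, sb]
  · simp [j2, alternating J hJt]

/-- `B(pᵢ, qⱼ) = 0`. [folklore] -/
private theorem pair_pq (i j : Fin 2) : (bP P hP2 i : V) ⬝ᵥ (J *ᵥ (bQ J P hP2 hPc j : V)) = 0 :=
  (mem_orth_iff J P _).mp (bQ J P hP2 hPc j).2 _ (bP P hP2 i).2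

/-- `B(qᵢ, pⱼ) = 0`. [folklore] -/
private theorem pair_qp (hJt : Jᵀ = -J) (i j : Fin 2) :
    (bQ J P hP2 hPc i : V) ⬝ᵥ (J *ᵥ (bP P hP2 j : V)) = 0 := by
  rw [skew J hJt, pair_pq, neg_zero]

/-- **The Gram matrix of `J` in the adapted basis is the standard form `G a b`.** [folklore] -/
private theorem gram_eq (hJt : Jᵀ = -J) :
    (Rm J P hP2 hPc * J * (Rm J P hP2 hPc)ᵀ).submatrix σ σ = G (sa J P hP2) (sb J P hP2 hPc) := by
  ext x y
  rw [Matrix.submatrix_apply, gram_apply, Rm_apply, Rm_apply, Equiv.symm_apply_apply,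
    Equiv.symm_apply_apply]
  rcases x with i | i <;> rcases y with j | j
  · rw [cols_inl, cols_inl, pair_pp J P hP2 hJt, G, Matrix.fromBlocks_apply₁₁]
  · rw [cols_inl, cols_inr, pair_pq, G, Matrix.fromBlocks_apply₁₂]; rfl
  · rw [cols_inr, cols_inl, pair_qp J P hP2 hPc hJt, G, Matrix.fromBlocks_apply₂₁]; rfl
  · rw [cols_inr, cols_inr, pair_qq J P hP2 hPc hJt, G, Matrix.fromBlocks_apply₂₂]

/-- `det (G a b) = a² b²`. [folklore] -/
private theorem det_G (a b : k) : (G a b).det = a ^ 2 * b ^ 2 := by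
  rw [G, Matrix.det_fromBlocks_zero₂₁, Matrix.det_smul, Matrix.det_smul, det_j2]
  simp

include hPc in
/-- The adapted basis matrix is invertible (`det (G a b) = det(Rm)² det J ≠ 0`). [folklore] -/
private theorem det_Rm_ne_zero (hJt : Jᵀ = -J) (hJd : J.det ≠ 0) : (Rm J P hP2 hPc).det ≠ 0 := by
  intro h0
  have h1 : ((Rm J P hP2 hPc * J * (Rm J P hP2 hPc)ᵀ).submatrix σ σ).det = 0 := by
    rw [Matrix.det_submatrix_equiv_self, Matrix.det_mul, Matrix.det_mul, Matrix.det_transpose, h0]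
    ring
  rw [gram_eq J P hP2 hPc hJt, det_G] at h1
  exact mul_ne_zero (pow_ne_zero 2 (sa_ne_zero J P hP2 hPc hJt))
    (pow_ne_zero 2 (sb_ne_zero J P hP2 hPc hJt hJd)) h1


/-! ### conjugation + re-indexing: the bijection `M ↦ (Q⁻¹ M Q)|_σ` with `Q = Rmᵀ` -/

/-- the change-of-basis matrix: columns `p₀, p₁, q₀, q₁` (in `σ`-order) [folklore] -/
noncomputable def Qm : Matrix (Fin 4) (Fin 4) k := (Rm J P hP2 hPc)ᵀ

/-- Re-indexing by `σ` is injective on matrices. [folklore] -/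
private theorem submatrix_σ_inj {X Y : Matrix (Fin 4) (Fin 4) k} :
    X.submatrix σ σ = Y.submatrix σ σ ↔ X = Y := by
  refine ⟨fun h => ?_, fun h => by rw [h]⟩
  have := congr_arg (fun Z : Matrix ι ι k => Z.submatrix σ.symm σ.symm) h
  simpa only [Matrix.submatrix_submatrix, Equiv.self_comp_symm, Matrix.submatrix_id_id] using this

/-- Re-indexing commutes with scalars. [folklore] -/
private theorem smul_submatrix_σ (c : k) (X : Matrix (Fin 4) (Fin 4) k) :
    (c • X).submatrix σ σ = c • X.submatrix σ σ := rfl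

section conj
variable (Q : Matrix (Fin 4) (Fin 4) k) (hQ : IsUnit Q.det)

/-- `Φ_Q M = (Q⁻¹ M Q)` re-indexed by `σ` [folklore] -/
noncomputable def Φ (M : Matrix (Fin 4) (Fin 4) k) : Matrix ι ι k := (Q⁻¹ * M * Q).submatrix σ σ

/-- its inverse [folklore] -/
noncomputable def Ψ (N : Matrix ι ι k) : Matrix (Fin 4) (Fin 4) k :=
  Q * N.submatrix σ.symm σ.symm * Q⁻¹

include hQ in
/-- `Ψ_Q ∘ Φ_Q = id` for invertible `Q`. [folklore] -/
private theorem Ψ_Φ (M : Matrix (Fin 4) (Fin 4) k) : Ψ Q (Φ Q M) = M := by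
  simp only [Φ, Ψ, Matrix.submatrix_submatrix, Equiv.self_comp_symm, Matrix.submatrix_id_id,
    Matrix.mul_assoc, Matrix.mul_nonsing_inv_cancel_left _ _ hQ, Matrix.mul_nonsing_inv _ hQ,
    Matrix.mul_one]

include hQ in
/-- `Φ_Q ∘ Ψ_Q = id` for invertible `Q`. [folklore] -/
private theorem Φ_Ψ (N : Matrix ι ι k) : Φ Q (Ψ Q N) = N := by
  simp only [Φ, Ψ, Matrix.mul_assoc, Matrix.nonsing_inv_mul_cancel_left _ _ hQ,
    Matrix.nonsing_inv_mul _ hQ, Matrix.mul_one, Matrix.submatrix_submatrix,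
    Equiv.symm_comp_self, Matrix.submatrix_id_id]

/-- the bijection of matrix spaces [folklore] -/
noncomputable def conjEquiv : Matrix (Fin 4) (Fin 4) k ≃ Matrix ι ι k where
  toFun := Φ Q
  invFun := Ψ Q
  left_inv := Ψ_Φ Q hQ
  right_inv := Φ_Ψ Q hQ

include hQ in
/-- conjugating the similitude equation [folklore] -/
private theorem conj_simil (J' M : Matrix (Fin 4) (Fin 4) k) :
    (Q⁻¹ * M * Q)ᵀ * (Qᵀ * J' * Q) * (Q⁻¹ * M * Q) = Qᵀ * (Mᵀ * J' * M) * Q := by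
  have hQt : IsUnit Qᵀ.det := by rwa [Matrix.det_transpose]
  simp only [Matrix.transpose_mul, Matrix.transpose_nonsing_inv, Matrix.mul_assoc,
    Matrix.nonsing_inv_mul_cancel_left _ _ hQt, Matrix.mul_nonsing_inv_cancel_left _ _ hQ]

include hQ in
/-- `Qᵀ X Q = Qᵀ Y Q ↔ X = Y` for invertible `Q`. [folklore] -/
private theorem sandwich_inj {X Y : Matrix (Fin 4) (Fin 4) k} : Qᵀ * X * Q = Qᵀ * Y * Q ↔ X = Y := by
  have hQt : IsUnit Qᵀ.det := by rwa [Matrix.det_transpose]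
  refine ⟨fun h => ?_, fun h => by rw [h]⟩
  have := congr_arg (fun Z => Qᵀ⁻¹ * Z * Q⁻¹) h
  simpa only [Matrix.mul_assoc, Matrix.nonsing_inv_mul_cancel_left _ _ hQt,
    Matrix.mul_nonsing_inv _ hQ, Matrix.mul_one] using this

include hQ in
/-- **(C1)** the similitude condition for `M` w.r.t. `J'` is the similitude condition for
`Φ_Q M` w.r.t. the re-indexed Gram matrix `(Qᵀ J' Q)|_σ`. [folklore] -/
private theorem simil_iff (J' M : Matrix (Fin 4) (Fin 4) k) (c : k) :
    (Φ Q M)ᵀ * (Qᵀ * J' * Q).submatrix σ σ * Φ Q M = c • (Qᵀ * J' * Q).submatrix σ σ ↔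
      Mᵀ * J' * M = c • J' := by
  rw [Φ, Matrix.transpose_submatrix, Matrix.submatrix_mul_equiv, Matrix.submatrix_mul_equiv,
    ← smul_submatrix_σ, submatrix_σ_inj, conj_simil Q hQ, ← sandwich_inj Q hQ (X := Mᵀ * J' * M),
    Matrix.mul_smul, Matrix.smul_mul]

/-- the linear map `θ_Q : v ↦ Q (v ∘ σ⁻¹)` from standard coordinates to `𝔽₃⁴` [folklore] -/
noncomputable def θL : (ι → k) →ₗ[k] V := (Matrix.toLin' Q).comp (LinearMap.funLeft k k σ.symm)

/-- `θ_Q v = Q (v ∘ σ⁻¹)` (unfolding). [folklore] -/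
private theorem θL_apply (v : ι → k) : θL Q v = Q *ᵥ (v ∘ σ.symm) := rfl

include hQ in
/-- `θ_Q` is injective for invertible `Q`. [folklore] -/
private theorem θL_injective : Function.Injective (θL Q) := by
  intro v w h
  rw [θL_apply, θL_apply] at h
  have hinj : Function.Injective Q.mulVec :=
    Matrix.mulVec_injective_iff_isUnit.mpr ((Matrix.isUnit_iff_isUnit_det Q).mpr hQ)
  have h2 := hinj h
  funext x
  have := congr_fun h2 (σ x)
  simpa using this

include hQ in
/-- **intertwining**: `M (θ v) = θ (Φ_Q M v)` [folklore] -/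
private theorem mulVec_θL (M : Matrix (Fin 4) (Fin 4) k) (v : ι → k) :
    M *ᵥ θL Q v = θL Q (Φ Q M *ᵥ v) := by
  rw [θL_apply, θL_apply, Φ, Matrix.submatrix_mulVec_equiv]
  have hc : ((Q⁻¹ * M * Q) *ᵥ (v ∘ ⇑σ.symm)) ∘ ⇑σ ∘ ⇑σ.symm = (Q⁻¹ * M * Q) *ᵥ (v ∘ ⇑σ.symm) := by
    rw [Equiv.self_comp_symm, Function.comp_id]
  rw [Function.comp_assoc, hc, Matrix.mulVec_mulVec, Matrix.mulVec_mulVec, Matrix.mul_assoc,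
    Matrix.mul_nonsing_inv_cancel_left _ _ hQ]

include hQ in
/-- `M(θ_Q(W)) = θ_Q((Φ_Q M)(W))` for every subspace `W`. [folklore] -/
private theorem map_map_θL (M : Matrix (Fin 4) (Fin 4) k) (W : Submodule k (ι → k)) :
    (W.map (θL Q)).map (Matrix.toLin' M) = (W.map (Matrix.toLin' (Φ Q M))).map (θL Q) := by
  have hcomp : (Matrix.toLin' M).comp (θL Q) = (θL Q).comp (Matrix.toLin' (Φ Q M)) := by
    apply LinearMap.ext
    intro v
    rw [LinearMap.comp_apply, LinearMap.comp_apply, Matrix.toLin'_apply, Matrix.toLin'_apply]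
    exact mulVec_θL Q hQ M v
  rw [← Submodule.map_comp (θL Q) (Matrix.toLin' M) W,
    ← Submodule.map_comp (Matrix.toLin' (Φ Q M)) (θL Q) W, hcomp]

include hQ in
/-- **(C2)** transfer of the plane conditions [folklore] -/
private theorem map_eq_iff (M : Matrix (Fin 4) (Fin 4) k) (W W' : Submodule k (ι → k)) :
    (W.map (θL Q)).map (Matrix.toLin' M) = W'.map (θL Q) ↔
      W.map (Matrix.toLin' (Φ Q M)) = W' := by
  rw [map_map_θL Q hQ]
  exact (Submodule.map_injective_of_injective (θL_injective Q hQ)).eq_iff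

end conj


/-! ### the adapted coordinates carry the coordinate planes onto `P` and `P^⊥` -/

/-- `Q w = Σ_c w_c · Rm_c` (columns of `Q` are the rows of `Rm`). [folklore] -/
private theorem Qm_mulVec (w : V) : Qm J P hP2 hPc *ᵥ w = ∑ c, w c • Rm J P hP2 hPc c := by
  funext r
  simp only [Qm, Matrix.mulVec, dotProduct, Matrix.transpose_apply, Finset.sum_apply,
    Pi.smul_apply, smul_eq_mul, mul_comm (w _)]

/-- `θ_Q v = Σ_x v_x · cols x`. [folklore] -/
private theorem θL_eq_sum (v : ι → k) :
    θL (Qm J P hP2 hPc) v = ∑ x : ι, v x • cols J P hP2 hPc x := by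
  rw [θL_apply, Qm_mulVec]
  simp only [Function.comp_apply, Rm_apply]
  exact Equiv.sum_comp σ.symm (fun x => v x • cols J P hP2 hPc x)

/-- `θ_Q (u, w) = Σ uᵢ pᵢ + Σ wᵢ qᵢ`. [folklore] -/
private theorem θL_sum_elim (u w : Fin 2 → k) :
    θL (Qm J P hP2 hPc) (Sum.elim u w) =
      (∑ i, u i • (bP P hP2 i : V)) + ∑ i, w i • (bQ J P hP2 hPc i : V) := by
  rw [θL_eq_sum, Fintype.sum_sum_type]
  simp only [Sum.elim_inl, Sum.elim_inr, cols_inl, cols_inr]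

/-- The adapted coordinates carry the coordinate plane `E` onto `P`. [folklore] -/
private theorem map_θL_Einl : Einl.map (θL (Qm J P hP2 hPc)) = P := by
  apply le_antisymm
  · rintro _ ⟨v, hv, rfl⟩
    rw [eq_sum_elim_of_mem_Einl hv, θL_sum_elim]
    simp only [Pi.zero_apply, zero_smul, Finset.sum_const_zero, add_zero]
    exact Submodule.sum_mem _ (fun i _ => Submodule.smul_mem _ _ (bP P hP2 i).2)
  · intro u hu
    refine ⟨Sum.elim ((bP P hP2).repr ⟨u, hu⟩) 0, sum_elim_zero_mem_Einl _, ?_⟩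
    rw [θL_sum_elim]
    simp only [Pi.zero_apply, zero_smul, Finset.sum_const_zero, add_zero]
    have hsum := congr_arg (fun x : P => (x : V)) ((bP P hP2).sum_repr ⟨u, hu⟩)
    simpa only [Fin.sum_univ_two, Submodule.coe_add, Submodule.coe_smul] using hsum

/-- The adapted coordinates carry the coordinate plane `E′` onto `P^⊥`. [folklore] -/
private theorem map_θL_Einr : Einr.map (θL (Qm J P hP2 hPc)) = orth J P := by
  apply le_antisymm
  · rintro _ ⟨v, hv, rfl⟩
    rw [eq_sum_elim_of_mem_Einr hv, θL_sum_elim]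
    simp only [Pi.zero_apply, zero_smul, Finset.sum_const_zero, zero_add]
    exact Submodule.sum_mem _ (fun i _ => Submodule.smul_mem _ _ (bQ J P hP2 hPc i).2)
  · intro w hw
    refine ⟨Sum.elim 0 ((bQ J P hP2 hPc).repr ⟨w, hw⟩), sum_elim_zero_mem_Einr _, ?_⟩
    rw [θL_sum_elim]
    simp only [Pi.zero_apply, zero_smul, Finset.sum_const_zero, zero_add]
    have hsum := congr_arg (fun x : orth J P => (x : V)) ((bQ J P hP2 hPc).sum_repr ⟨w, hw⟩)
    simpa only [Fin.sum_univ_two, Submodule.coe_add, Submodule.coe_smul] using hsum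

/-! ### the count -/

/-- the similitudes of `J` stabilising the pair `{P, P^⊥}` [folklore] -/
def stabSet : Set (Matrix (Fin 4) (Fin 4) k) :=
  {M | (∃ c : kˣ, Mᵀ * J * M = (c : k) • J) ∧
    (P.map (Matrix.toLin' M) = P ∨ P.map (Matrix.toLin' M) = (Matrix.toBilin' J).orthogonal P)}

include hP2 hPc in
/-- **(S⇒O), matrix form.** For an invertible alternating `J` on `𝔽₃⁴` and a plane `P` with
`𝔽₃⁴ = P ⊕ P^⊥`, exactly `2304` similitudes of `J` stabilise `{P, P^⊥}`. [folklore] -/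
private theorem card_stabSet_aux (hJt : Jᵀ = -J) (hJd : J.det ≠ 0) :
    Nat.card (stabSet J P) = 2304 := by
  have ha := sa_ne_zero J P hP2 hPc hJt
  have hb := sb_ne_zero J P hP2 hPc hJt hJd
  have hQ : IsUnit (Qm J P hP2 hPc).det := by
    rw [Qm, Matrix.det_transpose]
    exact isUnit_iff_ne_zero.mpr (det_Rm_ne_zero J P hP2 hPc hJt hJd)
  have hG : ((Qm J P hP2 hPc)ᵀ * J * Qm J P hP2 hPc).submatrix σ σ =
      G (sa J P hP2) (sb J P hP2 hPc) := by
    rw [Qm, Matrix.transpose_transpose]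
    exact gram_eq J P hP2 hPc hJt
  have key : ∀ M : Matrix (Fin 4) (Fin 4) k,
      M ∈ stabSet J P ↔
        (IsSim (sa J P hP2) (sb J P hP2 hPc) (Φ (Qm J P hP2 hPc) M) ∧
          (Einl.map (Matrix.toLin' (Φ (Qm J P hP2 hPc) M)) = Einl ∨
            Einl.map (Matrix.toLin' (Φ (Qm J P hP2 hPc) M)) = Einr)) := by
    intro M
    apply and_congr
    · constructor
      · rintro ⟨c, hc⟩
        refine ⟨(c : k), c.ne_zero, ?_⟩
        rw [← hG, simil_iff _ hQ]
        exact hc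
      · rintro ⟨c, hc0, hc⟩
        refine ⟨Units.mk0 c hc0, ?_⟩
        rw [Units.val_mk0, ← simil_iff _ hQ J M c, hG]
        exact hc
    · have e1 := map_eq_iff _ hQ M Einl Einl
      have e2 := map_eq_iff _ hQ M Einl Einr
      rw [map_θL_Einl] at e1
      rw [map_θL_Einl, map_θL_Einr] at e2
      exact or_congr e1 e2
  rw [← card_std ha hb]
  exact Nat.card_congr (Equiv.subtypeEquiv (conjEquiv _ hQ) key)

end bases

/-- **(S⇒O), matrix form.** Let `J ∈ M₄(𝔽₃)` be invertible and alternating (`Jᵀ = -J`) and let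
`P ≤ 𝔽₃⁴` be a plane (`dim P = 2`) with `𝔽₃⁴ = P ⊕ P^⊥`, `P^⊥ = (Matrix.toBilin' J).orthogonal P`
its (right) `J`-orthogonal.  Then exactly `2304` matrices `M` satisfy `Mᵀ J M = c J` for a unit `c`
and `M(P) ∈ {P, P^⊥}`: the stabiliser of the unordered pair `{P, P^⊥}` in `GSp(J)(𝔽₃)` has order
`2304 = 2 · |{(A, D) ∈ GL₂(𝔽₃)² : det A = det D}| = |Δ ⋊ ℤ/2|`, the printed order of the subgroup
`G₂₃₀₄` (class `3.45.1 | 2304` of [BCGP25, Table 6.4.4]).  Our proof of the printed count.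
[cite: CalegariChidambaramGhitza2019, Lemma 2] -/
theorem card_stabSet (J : Matrix (Fin 4) (Fin 4) (ZMod 3)) (hJt : Jᵀ = -J) (hJd : J.det ≠ 0)
    (P : Submodule (ZMod 3) (Fin 4 → ZMod 3)) (hP2 : Module.finrank (ZMod 3) P = 2)
    (hPc : IsCompl P ((Matrix.toBilin' J).orthogonal P)) : Nat.card (stabSet J P) = 2304 :=
  card_stabSet_aux J P hP2 hPc hJt hJd


end GSp4DecompStabCount

/-! ### The corollary for framed Galois representations -/

section corollary

open GSp4DecompStabCount Matrix

variable {F : Type*} [Field F]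

/-- **(S⇒O) for images of Galois representations.** Let `ρ : Γ_F → GL₄(𝔽₃)` be a framed Galois
representation, `J ∈ M₄(𝔽₃)` invertible alternating, and `P ≤ 𝔽₃⁴` a plane with
`𝔽₃⁴ = P ⊕ P^⊥` (`P^⊥ = (Matrix.toBilin' J).orthogonal P`).  If every `ρ(σ)` is a similitude of
`J` mapping `P` onto `P` or onto `P^⊥`, and every similitude of `J` mapping `P` onto `P` or onto
`P^⊥` is some `ρ(σ)` — i.e. the image of `ρ` is EXACTLY the stabiliser of `{P, P^⊥}` in
`GSp(J)(𝔽₃)` (the unfolded clauses of `FramedGaloisRep.HasDecompositionStabilizerImage`, the class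
`3.45.1 | 2304` of [BCGP25, Table 6.4.4]) — then the image subgroup `ρ.imageOn ⊤ ≤ GL₄(𝔽₃)` has
exactly `2304` elements: the hypothesis `hcard` of
`Literature.NumberTheory.DiophantineGeometry.bcgp2025_lemma643_modThreeImage_order2304`.
Proved (`card_stabSet`); the number is the printed order of the class.
[cite: CalegariChidambaramGhitza2019, Lemma 2] -/
theorem FramedGaloisRep.natCard_imageOn_top_of_decompositionStabilizer
    (ρ : FramedGaloisRep F (ZMod 3) 4) (J : Matrix (Fin 4) (Fin 4) (ZMod 3))
    (hJalt : Jᵀ = -J) (hJdet : IsUnit J.det)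
    (P : Submodule (ZMod 3) (Fin 4 → ZMod 3))
    (hP2 : Module.finrank (ZMod 3) P = 2)
    (hPc : IsCompl P ((Matrix.toBilin' J).orthogonal P))
    (hsymp : ∀ σ : Field.absoluteGaloisGroup F, ∃ c : (ZMod 3)ˣ,
      (((ρ σ : GL (Fin 4) (ZMod 3)) : Matrix (Fin 4) (Fin 4) (ZMod 3)))ᵀ * J *
        ((ρ σ : GL (Fin 4) (ZMod 3)) : Matrix (Fin 4) (Fin 4) (ZMod 3)) = (c : ZMod 3) • J)
    (hstab : ∀ σ : Field.absoluteGaloisGroup F,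
      P.map (Matrix.toLin' ((ρ σ : GL (Fin 4) (ZMod 3)) : Matrix (Fin 4) (Fin 4) (ZMod 3))) = P ∨
        P.map (Matrix.toLin' ((ρ σ : GL (Fin 4) (ZMod 3)) : Matrix (Fin 4) (Fin 4) (ZMod 3))) =
          (Matrix.toBilin' J).orthogonal P)
    (hfull : ∀ M : Matrix (Fin 4) (Fin 4) (ZMod 3),
      (∃ c : (ZMod 3)ˣ, Mᵀ * J * M = (c : ZMod 3) • J) →
        (P.map (Matrix.toLin' M) = P ∨ P.map (Matrix.toLin' M) = (Matrix.toBilin' J).orthogonal P) →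
          ∃ σ : Field.absoluteGaloisGroup F,
            ((ρ σ : GL (Fin 4) (ZMod 3)) : Matrix (Fin 4) (Fin 4) (ZMod 3)) = M) :
    Nat.card (ρ.imageOn ⊤) = 2304 := by
  rw [← card_stabSet J hJalt (IsUnit.ne_zero hJdet) P hP2 hPc]
  -- the image subgroup is in bijection with the stabiliser set, via `g ↦ g.val`
  have hmem : ∀ g : GL (Fin 4) (ZMod 3), g ∈ ρ.imageOn ⊤ →
      (g : Matrix (Fin 4) (Fin 4) (ZMod 3)) ∈ stabSet J P := by
    intro g hg
    obtain ⟨σ, -, rfl⟩ := (ρ.mem_imageOn_iff ⊤ g).mp hg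
    exact ⟨hsymp σ, hstab σ⟩
  refine Nat.card_congr (Equiv.ofBijective
    (fun g : ρ.imageOn ⊤ => (⟨(g.1 : Matrix (Fin 4) (Fin 4) (ZMod 3)), hmem g.1 g.2⟩ : stabSet J P))
    ⟨?_, ?_⟩)
  · rintro ⟨g, hg⟩ ⟨g', hg'⟩ h
    have hval : (g : Matrix (Fin 4) (Fin 4) (ZMod 3)) = g' := congr_arg Subtype.val h
    exact Subtype.ext (Units.ext hval)
  · rintro ⟨M, hsim, hst⟩
    obtain ⟨σ, hσ⟩ := hfull M hsim hst
    refine ⟨⟨ρ σ, (ρ.mem_imageOn_iff ⊤ _).mpr ⟨σ, Subgroup.mem_top σ, rfl⟩⟩, ?_⟩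
    exact Subtype.ext hσ

/-- **(S⇒O), `GL₄(𝔽₃)` form — the hypothesis `hSO` of
`card_imageOn_top_eq_of_hasDecompositionStabilizerImage` (file
`Bcgp2025ModThreeDecompositionImageModular.lean`), verbatim, now PROVED.**  For every invertible
alternating `J ∈ M₄(𝔽₃)` and every non-degenerate plane `P` (`Submodule.IsNondegeneratePlane J P`:
`dim P = 2`, `𝔽₃⁴ = P ⊕ P^⊥`), the elements `M ∈ GL₄(𝔽₃)` with `Mᵀ J M = c J` (`c ∈ 𝔽₃ˣ`) that
stabilise the pair `{P, P^⊥}` (`StabilizesPlanePair J P M`) number exactly `2304` — the printed order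
of `G₂₃₀₄ = Δ ⋊ ℤ/2` (class `3.45.1 | 2304` of [BCGP25, Table 6.4.4]).  From `card_stabSet`: a
similitude of an invertible `J` with unit multiplier is invertible (`det(M)² det J = c⁴ det J`), so
`M ↦ ↑M` is a bijection onto `stabSet J P`.
[cite: CalegariChidambaramGhitza2019, Lemma 2] -/
theorem natCard_GL_similitude_stabilizesPlanePair :
    ∀ J : Matrix (Fin 4) (Fin 4) (ZMod 3), Jᵀ = -J → IsUnit J.det →
      ∀ P : Submodule (ZMod 3) (Fin 4 → ZMod 3), Submodule.IsNondegeneratePlane J P →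
        Nat.card {M : GL (Fin 4) (ZMod 3) //
          (∃ c : (ZMod 3)ˣ, (M : Matrix (Fin 4) (Fin 4) (ZMod 3))ᵀ * J * M = (c : ZMod 3) • J) ∧
            StabilizesPlanePair J P (M : Matrix (Fin 4) (Fin 4) (ZMod 3))} = 2304 := by
  intro J hJt hJd P hP
  rw [← card_stabSet J hJt (IsUnit.ne_zero hJd) P hP.1 hP.2]
  refine Nat.card_congr (Equiv.ofBijective
    (fun g => (⟨(g.1 : Matrix (Fin 4) (Fin 4) (ZMod 3)), g.2.1, g.2.2⟩ : stabSet J P)) ⟨?_, ?_⟩)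
  · rintro ⟨g, hg⟩ ⟨g', hg'⟩ h
    have hval : (g : Matrix (Fin 4) (Fin 4) (ZMod 3)) = g' := congr_arg Subtype.val h
    exact Subtype.ext (Units.ext hval)
  · rintro ⟨M, ⟨c, hc⟩, hst⟩
    -- `M` is invertible: `det M · det J · det M = c⁴ · det J` with `c⁴ det J ≠ 0`
    have hdet : M.det ≠ 0 := by
      intro h0
      have h := congr_arg Matrix.det hc
      rw [Matrix.det_mul, Matrix.det_mul, Matrix.det_transpose, h0, mul_zero, Matrix.det_smul,
        Fintype.card_fin] at h
      exact mul_ne_zero (pow_ne_zero 4 c.ne_zero) (IsUnit.ne_zero hJd) h.symm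
    refine ⟨⟨Matrix.GeneralLinearGroup.mkOfDetNeZero M hdet, ⟨c, hc⟩, hst⟩, ?_⟩
    rfl

/-- **(S⇒O) for images of Galois representations, structural form.**  If `ρ : Γ_F → GL₄(𝔽₃)` is
valued in the similitudes of an invertible alternating `J` and its image is exactly the stabiliser
in `GSp(J)(𝔽₃)` of a non-degenerate plane pair (`ρ.HasDecompositionStabilizerImage J`, the class
`3.45.1 | 2304` of [BCGP25, Table 6.4.4]), then `Nat.card (ρ.imageOn ⊤) = 2304` — the hypothesis
`hcard` of `Literature.NumberTheory.DiophantineGeometry.bcgp2025_lemma643_modThreeImage_order2304`.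
(`F` and the multiplier are arbitrary here; for `F = ℚ` and multiplier `ε̄⁻¹` this is
`card_imageOn_top_eq_of_hasDecompositionStabilizerImage` with its `hSO` discharged by
`natCard_GL_similitude_stabilizesPlanePair`.)
[cite: CalegariChidambaramGhitza2019, Lemma 2] -/
theorem FramedGaloisRep.natCard_imageOn_top_of_hasDecompositionStabilizerImage
    (ρ : FramedGaloisRep F (ZMod 3) 4) (J : Matrix (Fin 4) (Fin 4) (ZMod 3))
    (hJalt : Jᵀ = -J) (hJdet : IsUnit J.det)
    (hsymp : ∀ σ : Field.absoluteGaloisGroup F, ∃ c : (ZMod 3)ˣ,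
      (((ρ σ : GL (Fin 4) (ZMod 3)) : Matrix (Fin 4) (Fin 4) (ZMod 3)))ᵀ * J *
        ((ρ σ : GL (Fin 4) (ZMod 3)) : Matrix (Fin 4) (Fin 4) (ZMod 3)) = (c : ZMod 3) • J)
    (himg : ρ.HasDecompositionStabilizerImage J) :
    Nat.card (ρ.imageOn ⊤) = 2304 := by
  obtain ⟨P, hP, hstab, hex⟩ := himg
  exact FramedGaloisRep.natCard_imageOn_top_of_decompositionStabilizer ρ J hJalt hJdet P hP.1 hP.2
    hsymp hstab hex

end corollary

end Literature.NumberTheory.GaloisRepresentations
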